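import Summits.QuantumFields.BalabanUV.T4Continuum.Support.NE7EffectiveFormCoarseCurlAllLevels
import HarnessLib

/-!
# NE7EffectiveFormLevelMonotone — THE FLAT-BACKGROUND EFFECTIVE QUADRATIC FORM IS MONOTONE NON-DECREASING IN THE NUMBER OF RENORMALISATION STEPS:
# `⟨v, Δ_{j+1} v⟩ ≤ ⟨v, Δ_{j+2} v⟩` for every coarse direction `v`, every `j`, every volume `N`, every `U(n)` (`d = 4`)

Lineage `b2b-balaban-t4-ne7-p1` (CRUX PROVER NE7 #1 = OWNER of BINDER row NE7), generation 116.  A structural corollary of the SHARP one-step bound ✓ `NE7CoarseCurlEnergyFlatSharp.coarse_curl_energy_le_sharp`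
(`Σ_P ‖curl_1 (TX)̃‖² ≤ (L⁴∕L^d)·Σ_p ‖curl_1 X̃‖²`, `= 1·` in `d = 4`) and the variational principle ✓ `NE7MinActHessianFlatCurl.minAct_hessian_flat_curl` (`D²m_{j+1}(0)[v,v] = min {w^{j+1}·Σ_p nhsNormSq(curl_1 X̃ p) :
levelQ' j 1 X = v}`): a competitor `X⋆` for the `(j+2)`-step problem yields the competitor `T X⋆` for the `(j+1)`-step problem (`levelQ' (j+1) 1 = levelQ' j 1 ∘ T`, ✓ `levelQ'_succ_flatCfg`) with no larger energy.
WHAT ([folklore]; 0 def, 0 sorry): **`effectiveForm_mono_level_flat`** (`L ≥ 2`, `0 < ε ≤ ε₀`, `N ≥ 1`, every `j`, every `v ∈ skewSub 4 n N`):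
  `D²(minAct 4 (sfClass 4 L N ε) L N (j+1) ∘ chart_1)(0)[v, v] ≤ D²(minAct 4 (sfClass 4 L N ε) L N (j+2) ∘ chart_1)(0)[v, v]`
— with ✓ `effectiveForm_ge_coarse_curl_flat_allLevels`: `Σ_P ‖curl_1 ṽ‖² ≤ ⟨v,Δ₁v⟩ ≤ ⟨v,Δ₂v⟩ ≤ …` at the flat background.  (No upper bound uniform in `j` is claimed.)
HONEST FRAMING: flat datum; `d = 4` normalisation (`stepWt = 1`); OUR minimisers (B11 (8) with `sfClass`); nothing of Bałaban's asserted; NOT NE7 as a spine node; spine 0∕9; NOT infinite volume,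
NOT mass gap, NOT BetaPertH, NOT Clay.
-/

set_option autoImplicit false

open scoped BigOperators Matrix Matrix.Norms.L2Operator Topology
open NormedSpace Finset

namespace Summit.QuantumFields.BalabanUV.T4Continuum.NE7EffectiveFormLevelMonotone

open Literature.MathematicalPhysics.QuantumFieldTheory.Balaban1983to89
open B7Prop1Explicit B7Prop2Explicit
open T4AveragingDeficitWall (curl)
open AveragingDeficitTorusChart (TDir chart chartDir)
open AveragingDeficitChartCalculus (coord)
open AveragingDeficitTwoLevelPrep (skewSub)
open AveragingDeficitMultiLevelPrep (tower levelQ' tower_ne_zero)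
open MinimalActionLevels (perWin stepWt stepWt_pos)
open MinimalActionSandwich (minAct)
open MinimalActionRate (sfClass)
open MinimalActionWitness (flatCfg)
open MatrixNorms (nhsNormSq nhsNormSq_nonneg)
open NE7MinActHessianFlatCurl (minAct_hessian_flat_curl)
open NE7FlatAverageCurlCommutation (fderiv_coord_flatCfg_mem_skewSub levelQ'_succ_flatCfg)
open NE7CoarseCurlEnergyFlatSharp (coarse_curl_energy_le_sharp)
open NE7EffectiveFormCoarseCurlAllLevels (tower_window stepWt_four)

noncomputable section

variable {n : Type} [Fintype n] [DecidableEq n]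

/-- **MONOTONICITY OF THE FLAT-BACKGROUND EFFECTIVE FORM IN THE LEVEL** (`d = 4`, every `U(n)`, `L ≥ 2`): for `0 < ε ≤ ε₀`, `N ≥ 1`, every `j` and every `v ∈ skewSub 4 n N`,
`D²(minAct_{j+1} ∘ chart_1)(0)[v, v] ≤ D²(minAct_{j+2} ∘ chart_1)(0)[v, v]`. [folklore] -/
theorem effectiveForm_mono_level_flat [Nonempty n] {L : ℕ} [NeZero L] (hL : 2 ≤ L) :
    ∃ ε₀ : ℝ, 0 < ε₀ ∧ ∀ ε : ℝ, 0 < ε → ε ≤ ε₀ → ∀ (N : ℕ) [NeZero N], 1 ≤ N → ∀ (j : ℕ) (v : ↥(skewSub 4 n N)),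
      fderiv ℝ (fderiv ℝ (fun y : ↥(skewSub 4 n N) => minAct 4 (sfClass 4 L N ε) L N (j + 1)
          (chart (ContinuousLinearMap.id ℝ (Matrix n n ℂ)) N (flatCfg : Site 4 → Fin 4 → (Matrix n n ℂ)ˣ) (y : TDir 4 n N)))) 0 v v
        ≤ fderiv ℝ (fderiv ℝ (fun y : ↥(skewSub 4 n N) => minAct 4 (sfClass 4 L N ε) L N (j + 2)
          (chart (ContinuousLinearMap.id ℝ (Matrix n n ℂ)) N (flatCfg : Site 4 → Fin 4 → (Matrix n n ℂ)ˣ) (y : TDir 4 n N)))) 0 v v := by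
  have hL0 : (L : ℝ) ≠ 0 := by exact_mod_cast (NeZero.ne L)
  obtain ⟨ε₀, hε₀, H⟩ := minAct_hessian_flat_curl (n := n) hL
  refine ⟨ε₀, hε₀, fun ε hε hεle N _ hN j v => ?_⟩
  haveI : NeZero (L * tower L N j) := ⟨Nat.mul_ne_zero (NeZero.ne L) (tower_ne_zero L N j)⟩
  haveI : NeZero (L * (L * tower L N j)) := ⟨Nat.mul_ne_zero (NeZero.ne L) (Nat.mul_ne_zero (NeZero.ne L) (tower_ne_zero L N j))⟩
  -- the `(j+2)`-step Hessian is attained at some `X⋆` on the finest lattice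
  obtain ⟨-, hleast2⟩ := H ε hε hεle N hN (j + 1)
  obtain ⟨Xs, hXv, hval⟩ := (hleast2 v).1
  -- the `(j+1)`-step Hessian is a lower bound of its variational set; `T X⋆` is a competitor
  obtain ⟨-, hleast1⟩ := H ε hε hεle N hN j
  set TX : TDir 4 n (L * tower L N j) :=
    (fderiv ℝ (coord (ContinuousLinearMap.id ℝ (Matrix n n ℂ)) L (L * tower L N j) (flatCfg : Site 4 → Fin 4 → (Matrix n n ℂ)ˣ)) 0)
      (Xs : TDir 4 n (L * tower L N (j + 1))) with hTX
  have hTXskew : TX ∈ skewSub 4 n (L * tower L N j) := fderiv_coord_flatCfg_mem_skewSub Xs.2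
  have hTXv : levelQ' L N j (flatCfg : Site 4 → Fin 4 → (Matrix n n ℂ)ˣ) ((⟨TX, hTXskew⟩ : ↥(skewSub 4 n (L * tower L N j))) : TDir 4 n (L * tower L N j)) = v := by
    rw [← hXv]
    exact (levelQ'_succ_flatCfg j (Xs : TDir 4 n (L * tower L N (j + 1)))).symm
  have hmem := (hleast1 v).2 ⟨⟨TX, hTXskew⟩, hTXv, rfl⟩
  -- the one-step sharp comparison of the energies
  have hB := coarse_curl_energy_le_sharp (L := L) (M := L * tower L N j)
    ((Xs : TDir 4 n (L * tower L N (j + 1))) : TDir 4 n (L * (L * tower L N j)))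
  have hW1 : perWin 4 (L * tower L N j) = perWin 4 (N * L ^ (j + 1)) := by rw [tower_window]
  have hW2 : perWin 4 (L * (L * tower L N j)) = perWin 4 (N * L ^ (j + 1 + 1)) := by
    rw [show L * (L * tower L N j) = L * tower L N (j + 1) from rfl, tower_window]
  rw [hW1, hW2, div_self (pow_ne_zero 4 hL0), one_mul] at hB
  rw [show j + 2 = j + 1 + 1 from rfl, hval]
  refine hmem.trans ?_
  rw [stepWt_four, inv_one, one_pow, one_mul, one_pow, one_mul]
  exact hB

end

end Summit.QuantumFields.BalabanUV.T4Continuum.NE7EffectiveFormLevelMonotone
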